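import Summits.BirchSwinnertonDyer.BirchSwinnertonDyer.Theorems.EisensteinPrimesAcTwistDeformationCotorsion
import Summits.BirchSwinnertonDyer.BirchSwinnertonDyer.Theorems.EisensteinPrimesUnramifiedLeAwayKer
import Summits.BirchSwinnertonDyer.BirchSwinnertonDyer.Theorems.EisensteinPrimesTwoVariableSelmerControl
import Summits.BirchSwinnertonDyer.BirchSwinnertonDyer.Theorems.UniversalToricDescentTwistedSplitPlaces
import Summits.BirchSwinnertonDyer.Rank1Residual.X11b.CoinvariantsDescent
import Literature.NumberTheory.EllipticCurves.Castella2018.AnticyclotomicSelmerDualModuleFinite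
import Literature.NumberTheory.EllipticCurves.AnticyclotomicSignedLocalConditions
import Literature.NumberTheory.EllipticCurves.BigRepModuleShapiroSelmerConditionsProofs
import Literature.NumberTheory.EllipticCurves.PrimaryTorsionGaloisRep
import HarnessLib

/-!
# Route `EisensteinPrimes` (rung K5), crux 2 `GoodLatticeBDPValue`, line `halves` v19.1, V21 index road
# input S2 (SUR_f at `v̄`) — the instance, part 3: **`corank_Λ S_{𝓛_v}(K, 𝐃_E) = 0` (and cofinite
# generation) FROM the `Λ`-cotorsion of Castella's `X_ac(E/K_∞) = Sel_v̄(K_∞, E[p^∞])^∨`**, through the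
# Shapiro descent (helper for stmt-BirchSwinnertonDyer-19032)

Cell `bsd-eis` (home `run/shared/lean/pub/bsd-eis/`), seat `bsd-line-x1-p1-w3` gen 3 (D-0154 width seat
on crux 2 `GoodLatticeBDPValue`, line `halves` v19.1; LEAD g4's V21 index road §4 S2, curve side). The ONE
remaining input of the seat's `primaryTorsion_fullAt_SUR` (SUR(`𝐃_E`, `𝓛_v`)) beyond the published facts is
`hSel : corank_Λ S_{𝓛_v}(K, 𝐃_E) = 0`, `𝐃_E = bigRep κ ρ₀`, `ρ₀` the descended action of `G_{K,S}` on
`E[p^∞] = PrimaryTorsion W.geomPoints p`. THIS FILE is the E-side twin of LEAD g2's [RH]-transport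
(`AcTwistDeformation.hasCorank_fullAtSelmer_zero_of_datumDualData`, p624xxx): the Shapiro descent
`F : H¹(K_Σ/K, 𝐃_E) → H¹(K_∞, E[p^∞])` (g2's `exists_shapiroDescent`, injective, `T ↔ conj_γ − 1`) sends
`S_{𝓛_v}(K, 𝐃_E)` INTO CASTELLA'S `Sel_v̄(K_∞, E[p^∞]) = selmerAc W p κ v̄ ∅` (strict at `v̄` and at the places
of `S` from `loc = 0`; at the GOOD places `w ∉ S`, `w ∤ p`: unramified (g2) ⟹ locally trivial, by cell
`bsd-wall`'s `UniversalToricDescentTwistedDescent.unramifiedKer_le_awayKer_kerSubgroup_of_decomp_le` (totally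
split `w`, `Frob − 1` onto `E[p^∞]`) or g2's `unramifiedKer_le_awayKer_of_not_decomp_le` (finitely decomposed
`w`, pro-`p′` residual group); archimedean conditions vacuous at complex places), so Castella's dual pair
`XAc.isDualPair` (cell `bsd-eis` k5-ty) surjects `Λ`-linearly onto `Hom(S_{𝓛_v}, ℚ/ℤ)`
(`IwasawaDual.IsDualPair.exists_linearMap_comp_surjective`):

* **`hasCorank_fullAtSelmer_zero_of_xAc`** — for `K` totally complex, `v ≠ v̄` above `p` in `S`,
  good reduction off `S ∪ {w ∣ p}`, `γ` a topological generator of `κ`, and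
  `X_ac(E/K_∞)` (`Σ = ∅`) finitely generated and `Λ`-torsion:
  `corank_Λ S_{𝓛_v}(K, 𝐃_E) = 0` ∧ `S_{𝓛_v}(K, 𝐃_E)` cofinitely generated.

At the crux (`W = E_K`, `K` imaginary quadratic, `Sf` = places over `N_E`) the input is KERNEL: LEAD g3's
`Thm141TorsionClauses.moduleFinite_isTorsion_muInvariant_eq_zero_of_forall_dualData` (p635638; fed by
[PWL-θ]'s first clause). Theorems only; no definition, no named fact, no `sorry`. HONEST FRAMING: closes
nothing by itself (`--supports`); no summit statement / BSD / IMC2 / KY Thm. 1.4.1 (iii) is proved by this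
file. References: [Greenberg2006] Thm. 3 p. 342 ("as `Λ`-modules"); [Castella2018] §2.2 Def. 2.2;
[GreenbergLNM1716] §1 p. 60, §3 Lemma 3.3; [GreenbergVatsal2000] §2 p. 17; [Greenberg1989] §1 p. 98.
-/

set_option autoImplicit false
set_option linter.dupNamespace false

noncomputable section

open scoped Classical
open NumberField IsDedekindDomain Field PowerSeries
open Literature.NumberTheory.EllipticCurves Literature.NumberTheory.EllipticCurves.GreenbergSelmer
  Literature.NumberTheory.EllipticCurves.GreenbergVatsal2000 Literature.NumberTheory.GaloisRepresentations
  Literature.NumberTheory.EllipticCurves.IwasawaDual Literature.NumberTheory.EllipticCurves.Castella2018.AcSelmer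
  Literature.NumberTheory.IwasawaTheory Literature.NumberTheory.IwasawaTheory.Greenberg2016
  Literature.NumberTheory.IwasawaTheory.Greenberg2006
  Summit.BirchSwinnertonDyer.BirchSwinnertonDyer.Theorems.GreenbergFullAtSelmer

namespace Summit.BirchSwinnertonDyer.BirchSwinnertonDyer.Theorems.AcTwistDeformation

section CurveTransport

variable {K : Type} [Field K] [NumberField K] (S : Set (HeightOneSpectrum (𝓞 K))) {p : ℕ} [Fact p.Prime]
  (W : WeierstrassCurve K) [W.IsElliptic]
  [TopologicalSpace (PowerSeries ℤ_[p])] [IsTopologicalRing (PowerSeries ℤ_[p])]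
  [IsTopologicalAddGroup (BigRepModule ℤ_[p] p (PrimaryTorsion W.geomPoints p))]
  [ContinuousSMul (PowerSeries ℤ_[p]) (BigRepModule ℤ_[p] p (PrimaryTorsion W.geomPoints p))]
  (hS : ∀ v : HeightOneSpectrum (𝓞 K), ((p : ℕ) : 𝓞 K) ∈ v.asIdeal → v ∈ S)
  (κ : ZpExtension K p)
  (ρ₀ : ContinuousRep (GaloisGroupUnramifiedOutside K S) ℤ_[p] (PrimaryTorsion W.geomPoints p))

/-- **`corank_Λ S_{𝓛_v}(K, 𝐃_E) = 0` and `S_{𝓛_v}(K, 𝐃_E)` cofinitely generated, FROM THE `Λ`-COTORSION OF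
`X_ac(E/K_∞)`.** Data: `W/K` elliptic, `K` totally complex, `v ≠ v̄` above `p` with `S ∋ v, v̄`
with `W` good at every `w ∉ S`, `w ∤ p`, a continuous `ℤ_p`-linear `ρ₀` of `G_{K,S}` on `E[p^∞]` with
`ρ₀(σ̄) P = σ • P`, a topological generator `γ` of `κ`, and Castella's `X_ac = XAc W p κ v̄ ∅ γ` FINITELY
GENERATED AND TORSION. Along the injective Shapiro descent `S_{𝓛_v}(K, 𝐃_E) ↪ Sel_v̄(K_∞, E[p^∞])` (strict at
`v̄`/`S` by `loc = 0`; unramified ⟹ locally trivial at the good `w ∉ S`; no archimedean condition at complex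
places), which intertwines `T` with `conj_γ − 1`, Castella's dual pair surjects `Λ`-linearly onto
`Hom(S_{𝓛_v}, ℚ/ℤ)`. This is the hypothesis `hSel` of `primaryTorsion_fullAt_SUR` / `primaryTorsion_leo_h2`.
[cite: Greenberg2006, Thm. 3 p. 342 ("as Λ-modules")] [cite: Castella2018, §2.2 Def. 2.2 (arXiv:1704.06608 p. 5)]
[cite: GreenbergLNM1716, §1 p. 60, §3 Lemma 3.3 (p. 87)] [cite: GreenbergVatsal2000, §2 p. 17] -/
theorem hasCorank_fullAtSelmer_zero_of_xAc
    (hρ₀ : ∀ (σ : absoluteGaloisGroup K) (P : PrimaryTorsion W.geomPoints p),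
      ρ₀ (toUnramifiedQuot K S σ) P = σ • P)
    (hKc : ∀ w : InfinitePlace K, w.IsComplex)
    {γ : absoluteGaloisGroup K} [hγ : Fact (κ.IsTopGenerator γ)]
    {v vbar : HeightOneSpectrum (𝓞 K)} (hv : ((p : ℕ) : 𝓞 K) ∈ v.asIdeal)
    (hvbar : ((p : ℕ) : 𝓞 K) ∈ vbar.asIdeal) (hne : vbar ≠ v)
    (hgood : ∀ w : HeightOneSpectrum (𝓞 K), w ∉ S → ((p : ℕ) : 𝓞 K) ∉ w.asIdeal → W.HasGoodReductionAt w)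
    (hXfin : Module.Finite (IwasawaAlgebra p) (XAc W p κ vbar (∅ : Set (HeightOneSpectrum (𝓞 K))) γ))
    (hXtor : Module.IsTorsion (IwasawaAlgebra p) (XAc W p κ vbar (∅ : Set (HeightOneSpectrum (𝓞 K))) γ)) :
    HasCorank (PowerSeries ℤ_[p])
        (fullAtSpecification S (bigRep (κ.liftUnramifiedOutside S hS) ρ₀) (Sum.inr v)).selmer 0 ∧
      IsCofinitelyGenerated (PowerSeries ℤ_[p])
        (fullAtSpecification S (bigRep (κ.liftUnramifiedOutside S hS) ρ₀) (Sum.inr v)).selmer := by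
  set L := fullAtSpecification S (bigRep (κ.liftUnramifiedOutside S hS) ρ₀) (Sum.inr v) with hL
  -- the model: `A = PrimaryTorsion W.geomPoints p ≃+ M = W.geomPrimaryTorsion p`, `ψ = id`
  let ψ : PrimaryTorsion W.geomPoints p ≃+ W.geomPrimaryTorsion p := AddEquiv.refl _
  have hψ : ∀ (σ : absoluteGaloisGroup K) (a : PrimaryTorsion W.geomPoints p),
      ψ (ρ₀ (toUnramifiedQuot K S σ) a) = σ • ψ a := fun σ a ↦ by rw [hρ₀]; rfl
  have hA : ∀ a : PrimaryTorsion W.geomPoints p, ∃ k : ℕ, p ^ k • a = 0 := fun a ↦ by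
    obtain ⟨k, hk⟩ := a.exists_pow_smul_eq_zero
    exact ⟨k, PrimaryTorsion.ext (by rw [PrimaryTorsion.val_nsmul]; exact hk)⟩
  have hM : ∀ m : W.geomPrimaryTorsion p, ∃ k : ℕ, p ^ k • m = 0 := fun m ↦ hA m
  have hstab : ∀ m : W.geomPrimaryTorsion p,
      IsOpen (MulAction.stabilizer (absoluteGaloisGroup K) m : Set (absoluteGaloisGroup K)) :=
    AcSigned.isOpen_stabilizer_geomPrimaryTorsion W
  obtain ⟨F, hF⟩ := exists_shapiroDescent S hS κ ρ₀ ψ hψ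
  -- the two dual pairs
  have h := XAc.isDualPair W p κ vbar (∅ : Set (HeightOneSpectrum (𝓞 K))) γ
  have h' := isDualPair_characterModule_selmer S hS κ ρ₀ L
  -- the descent lands in Castella's `Sel_v̄(K_∞, E[p^∞])`
  have hmem : ∀ s : L.selmer, F (s : (bigRep (κ.liftUnramifiedOutside S hS) ρ₀).H 1) ∈
      selmerAc W p κ vbar (∅ : Set (HeightOneSpectrum (𝓞 K))) := by
    rintro ⟨ξ, hξ⟩
    obtain ⟨c, rfl⟩ := oneCocycleClass_surjective _ ξ
    rw [mem_selmer_fullAtSpecification_iff] at hξ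
    have hloc : ∀ w : HeightOneSpectrum (𝓞 K), w ∈ S → w ≠ v →
        loc S (bigRep (κ.liftUnramifiedOutside S hS) ρ₀) (Sum.inr w) 1 (oneCocycleClass _ c) = 0 :=
      fun w hw hwv ↦ hξ ⟨Sum.inr w, (inSigma_inr_iff S w).mpr hw⟩ (fun e ↦ hwv (Sum.inr_injective e))
    change F (oneCocycleClass _ c) ∈ selmerOver κ.kerSubgroup (W.geomPrimaryTorsion p) p vbar ∅
    rw [mem_selmerOver_iff]
    refine ⟨fun w hpw _ σ ↦ ?_, fun w σ ↦ ?_, fun σ ↦ ?_⟩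
    · by_cases hwS : w ∈ S
      · have hwv : w ≠ v := fun e ↦ hpw (e ▸ hv)
        exact conjH1_shapiroDescent_mem_awayKer_of_loc_eq_zero S hS κ ρ₀ ψ hψ hA hF w c (hloc w hwS hwv) σ
      · -- good `w ∉ S`, `w ∤ p`: unramified ⟹ locally trivial
        have hunr := conjH1_shapiroDescent_mem_unramifiedKer_of_not_mem S hS κ ρ₀ ψ hψ hF hwS c σ
        by_cases hD : decomp (K := K) w ≤ κ.kerSubgroup
        · exact UniversalToricDescentTwistedDescent.unramifiedKer_le_awayKer_kerSubgroup_of_decomp_le W p κ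
            hpw (hgood w hwS hpw) hD hunr
        · exact UnramifiedLeAwayKer.unramifiedKer_le_awayKer_of_not_decomp_le (κ := κ) hstab hM
            (IwasawaTwoVariable.inertia_le_kerSubgroup_of_not_mem κ hpw) hD hunr
    · exact Summit.BirchSwinnertonDyer.Rank1Residual.X11b.Coinv.mem_infKer_of_decompInf_eq_bot w
        (BigGaloisRep.decompInf_eq_bot_of_isComplex (hKc w)) _
    · rw [Literature.NumberTheory.EllipticCurves.BigGaloisRep.strictKer_strictDatum_eq_awayKer]
      exact conjH1_shapiroDescent_mem_awayKer_of_loc_eq_zero S hS κ ρ₀ ψ hψ hA hF vbar c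
        (hloc vbar (hS vbar hvbar) hne) σ
  let φ : L.selmer →+ selmerAc W p κ vbar (∅ : Set (HeightOneSpectrum (𝓞 K))) :=
    { toFun := fun s ↦ ⟨F s, hmem s⟩
      map_zero' := Subtype.ext (by simp)
      map_add' := fun s t ↦ Subtype.ext (by simp) }
  have hφ : ∀ s : L.selmer, φ (DistribSMul.toAddMonoidHom L.selmer (PowerSeries.X : PowerSeries ℤ_[p]) s) =
      (conjSelmerAc W p κ vbar (∅ : Set (HeightOneSpectrum (𝓞 K))) γ - 1) (φ s) := fun s ↦ by
    apply Subtype.ext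
    change F ((PowerSeries.X : PowerSeries ℤ_[p]) • (s : (bigRep (κ.liftUnramifiedOutside S hS) ρ₀).H 1)) =
      W.conjH1 p κ.kerSubgroup γ (F s) - F s
    exact shapiroDescent_X_smul S hS κ ρ₀ ψ hψ hF hγ.out _
  have hinj : Function.Injective φ := by
    refine (injective_iff_map_eq_zero φ).2 fun s hs ↦ ?_
    have h0 : F (s : (bigRep (κ.liftUnramifiedOutside S hS) ρ₀).H 1) = 0 := congrArg Subtype.val hs
    obtain ⟨c, hc⟩ := oneCocycleClass_surjective _ (s : (bigRep (κ.liftUnramifiedOutside S hS) ρ₀).H 1)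
    rw [← hc] at h0
    exact Subtype.ext (hc.symm.trans
      (oneCocycleClass_eq_zero_of_shapiroDescent_eq_zero S hS κ ρ₀ ψ hψ hA hF c h0))
  -- functoriality of dual pairs: `X_ac ↠ Hom(S_𝓛, ℚ/ℤ)`, `Λ`-linear
  obtain ⟨G, hGsurj, -⟩ := h.exists_linearMap_comp_surjective h' φ hφ hinj
  haveI : Module.Finite (PowerSeries ℤ_[p]) (XAc W p κ vbar (∅ : Set (HeightOneSpectrum (𝓞 K))) γ) := hXfin
  have hfin : Module.Finite (PowerSeries ℤ_[p]) (CharacterModule L.selmer) := Module.Finite.of_surjective G hGsurj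
  have htor : Module.IsTorsion (PowerSeries ℤ_[p]) (CharacterModule L.selmer) := fun x ↦ by
    obtain ⟨y, rfl⟩ := hGsurj x
    obtain ⟨a, ha⟩ := @hXtor y
    refine ⟨a, ?_⟩
    rw [Submonoid.smul_def] at ha ⊢
    rw [← map_smul, ha, map_zero]
  refine ⟨fun Y _ _ toDual hY ↦ ?_, fun Y _ _ toDual hY ↦ ?_⟩
  · let e := hY.linearEquiv (isDualPairing_characterModule (PowerSeries ℤ_[p]) L.selmer)
    haveI : Module.Finite (PowerSeries ℤ_[p]) Y := Module.Finite.equiv e.symm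
    refine (Module.finrank_eq_zero_iff_isTorsion (R := PowerSeries ℤ_[p]) (M := Y)).mpr fun y ↦ ?_
    obtain ⟨a, ha⟩ := @htor (e y)
    refine ⟨a, e.injective ?_⟩
    rw [Submonoid.smul_def] at ha ⊢
    rw [map_smul, ha, map_zero]
  · let e := hY.linearEquiv (isDualPairing_characterModule (PowerSeries ℤ_[p]) L.selmer)
    exact Module.Finite.equiv e.symm

end CurveTransport

end Summit.BirchSwinnertonDyer.BirchSwinnertonDyer.Theorems.AcTwistDeformation

end
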